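import Literature.MathematicalPhysics.QuantumLattice.MagneticHubbardTorusPeierls
import Literature.MathematicalPhysics.QuantumLattice.FinDimSpectrumSectorGibbsLimit
import HarnessLib

/-!
# Bloch's theorem on the Hubbard torus: sector ground states carry `O(K/L)` current

Topic `Literature/MathematicalPhysics/QuantumLattice` (family `hubbard`); companion of
`MagneticHubbardTorusGauge.lean`, `MagneticHubbardTorusPeierls.lean`, `HubbardTorusFluxBlochBound.lean`.
Everything here is PROVED; no definitions, no named facts.

For a unit vector `φ` of a joint sector `(N, S^z = M)` of the Hubbard torus `H = hubbardTorus 2 L 1 U`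
(`L ≥ 3`) write `h_{x,0,σ}(φ) = ⟨φ, c†_{x+e₁,σ} c_{x,σ} φ⟩`, `K(φ) = Σ_{x,σ} Re h_{x,0,σ}(φ)` (half the
`e₁`-kinetic weight) and `J̃(φ) = Σ_{x,σ} Im h_{x,0,σ}(φ)` (minus half the total `e₁`-current).

* `minEnergyOn_uniformTwistConfig_le_rayleigh` — pricing `φ` in the uniformly twisted torus
  (`e^{iΦ/L}` on every `e₁`-bond): `E₀(H_Φ; N,M) ≤ Re⟨φ,Hφ⟩ + 2(1 − cos(Φ/L)) K(φ) + 2 sin(Φ/L) J̃(φ)`;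
* `minEnergyOn_uniformTwistConfig_int_mul_two_pi` — an integer number of flux quanta spread uniformly
  is a pure gauge: `E₀(H_{2πm}; N,M) = E₀(H; N,M)` (the Lieb–Schultz–Mattis twist `U_m` is a
  sector-preserving unitary);
* `bloch_intTwist_le` — hence `−2(1 − cos(2πm/L)) K(φ) − 2 sin(2πm/L) J̃(φ) ≤ Re⟨φ,Hφ⟩ − E₀(H; N,M)`
  for every `m : ℤ` (Watanabe 2019, eqs. (13)–(16));
* `bloch_abs_current_le`, `bloch_abs_current_le_of_minEnergy` — **Bloch's theorem**:
  `|sin(2π/L)|·|2J̃(φ)| ≤ (1 − cos(2π/L))·2K(φ) + (Re⟨φ,Hφ⟩ − E₀)`; in particular a vector attaining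
  the sector ground energy carries a current `|2J̃| ≤ tan(π/L)·2K ≈ (2π/L)·K`: persistent currents of
  ground states are `O(K/L)` (Bohm 1949; Watanabe 2019, Theorem of §2.2.1; Tada–Koma 2016 §2).

## References

* D. Bohm, Phys. Rev. 75 (1949) 502. [Bohm1949]
* H. Watanabe, J. Stat. Phys. 177 (2019) 717, §2.2.1 eqs. (13)–(16), §4.1. [Watanabe2019]
* Y. Tada, T. Koma, J. Stat. Phys. 165 (2016) 455, §2. [TadaKoma2016]
* E. Lieb, T. Schultz, D. Mattis, Ann. Phys. 16 (1961) 407. [LiebSchultzMattisAP1961]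
-/

noncomputable section

namespace Literature.MathematicalPhysics.QuantumLattice

open Matrix Finset Literature.MathematicalPhysics.QuantumFieldTheory
open scoped ComplexConjugate

variable {L : ℕ} [NeZero L]

/-- **Pricing in the uniformly twisted torus** (`L ≥ 3`): for every unit vector `φ` of the joint
sector `(N, S^z = M)` and every total twist `Φ`,
`E₀(H_Φ; N,M) ≤ Re⟨φ,Hφ⟩ + 2(1 − cos(Φ/L)) K(φ) + 2 sin(Φ/L) J̃(φ)` (variational principle for the
twisted Hamiltonian with `φ` itself as trial vector, unfolded bond by bond).
Watanabe, J. Stat. Phys. 177 (2019) 717, §2.2.1 eqs. (13)–(16). [cite: Watanabe2019, §2.2.3 and §4.1] -/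
theorem minEnergyOn_uniformTwistConfig_le_rayleigh (hL : 3 ≤ L) (U : ℝ) (N : ℕ) (M : ℝ) (Φ : ℝ)
    (φ : Fock (Orb (FermionTorus 2 L))) (hφ : φ ∈ szSector N M) (h1 : star φ ⬝ᵥ φ = 1) :
    (magneticHubbardTorus L (uniformTwistConfig L Φ) 1 U).minEnergyOn (szSector N M) ≤
      (star φ ⬝ᵥ (hubbardTorus 2 L 1 U *ᵥ φ)).re +
        2 * (1 - Real.cos (Φ / L)) *
          (∑ x : Site 2 L, ∑ σ : Fin 2,
            (star φ ⬝ᵥ ((creation (orb (FermionTorus.ofTorusSite (Site.shift x 0)) σ) *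
              annihilation (orb (FermionTorus.ofTorusSite x) σ)) *ᵥ φ)).re) +
        2 * Real.sin (Φ / L) *
          (∑ x : Site 2 L, ∑ σ : Fin 2,
            (star φ ⬝ᵥ ((creation (orb (FermionTorus.ofTorusSite (Site.shift x 0)) σ) *
              annihilation (orb (FermionTorus.ofTorusSite x) σ)) *ᵥ φ)).im) := by
  refine (minEnergyOn_le_rayleigh_of_mem (magneticHubbardTorus_isHermitian _ 1 U) _ hφ h1).trans_eq ?_
  rw [re_star_dotProduct_magneticHubbardTorus_uniformTwistConfig_mulVec,
    magneticHubbardTorus_one_eq_hubbardTorus hL]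

/-- **Integer flux quanta spread uniformly are pure gauges** (`L ≥ 3`): the torus with the uniform
twist `e^{2πim/L}` on the `e₁`-bonds has the sector energies of `hubbardTorus 2 L 1 U` (uniform twist
≃ seam flux `2πm` ≃ seam flux `0`). Watanabe (2019) §2.2.3 (`U_m` is a symmetry up to the seam phase
`e^{2πim} = 1`). [cite: Watanabe2019, §2.2.3 and §4.1] -/
theorem minEnergyOn_uniformTwistConfig_int_mul_two_pi (hL : 3 ≤ L) (U : ℝ) (N : ℕ) (M : ℝ) (m : ℤ) :
    (magneticHubbardTorus L (uniformTwistConfig L (m * (2 * Real.pi))) 1 U).minEnergyOn (szSector N M) =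
      (hubbardTorus 2 L 1 U).minEnergyOn (szSector N M) := by
  rw [minEnergyOn_szSector_uniformTwistConfig (by omega), ← hubbardTorusFlux_eq_magneticHubbardTorus hL,
    (hubbardTorusFlux_periodic L U).int_mul_eq m, hubbardTorusFlux_zero]

/-- **Bloch's inequality for integer twists**: for every unit vector `φ` of any joint sector
`(N, S^z = M)` and every `m : ℤ`,
`−2(1 − cos(2πm/L)) K(φ) − 2 sin(2πm/L) J̃(φ) ≤ Re⟨φ,Hφ⟩ − E₀(N,M)` (the Lieb–Schultz–Mattis /
Bloch twist `U_m` is sector preserving and costs exactly the left-hand side to all orders).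
Bohm (1949); Watanabe (2019) §2.2.1 eqs. (13)–(15); Tada–Koma (2016) §2. [cite: Watanabe2019, §2.2.3 and §4.1] -/
theorem bloch_intTwist_le (hL : 3 ≤ L) (U : ℝ) (N : ℕ) (M : ℝ) (m : ℤ)
    (φ : Fock (Orb (FermionTorus 2 L))) (hφ : φ ∈ szSector N M) (h1 : star φ ⬝ᵥ φ = 1) :
    -(2 * (1 - Real.cos (m * (2 * Real.pi) / L)) *
          (∑ x : Site 2 L, ∑ σ : Fin 2,
            (star φ ⬝ᵥ ((creation (orb (FermionTorus.ofTorusSite (Site.shift x 0)) σ) *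
              annihilation (orb (FermionTorus.ofTorusSite x) σ)) *ᵥ φ)).re))
      - 2 * Real.sin (m * (2 * Real.pi) / L) *
          (∑ x : Site 2 L, ∑ σ : Fin 2,
            (star φ ⬝ᵥ ((creation (orb (FermionTorus.ofTorusSite (Site.shift x 0)) σ) *
              annihilation (orb (FermionTorus.ofTorusSite x) σ)) *ᵥ φ)).im) ≤
      (star φ ⬝ᵥ (hubbardTorus 2 L 1 U *ᵥ φ)).re -
        (hubbardTorus 2 L 1 U).minEnergyOn (szSector N M) := by
  have h := minEnergyOn_uniformTwistConfig_le_rayleigh hL U N M (m * (2 * Real.pi)) φ hφ h1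
  rw [minEnergyOn_uniformTwistConfig_int_mul_two_pi hL] at h
  linarith

/-- **Bloch's theorem on the torus, variational form** (one flux quantum each way): for every unit
vector `φ` of any joint sector `(N, S^z = M)`,
`|sin(2π/L) · 2J̃(φ)| ≤ (1 − cos(2π/L)) · 2K(φ) + (Re⟨φ,Hφ⟩ − E₀(N,M))` — a state whose
`e₁`-current exceeds `≈ (π/L)·2K(φ)` plus `L/2π` times its own excitation energy can be unwound below
the sector ground energy. Bohm, Phys. Rev. 75 (1949) 502; Watanabe (2019) §2.2.1. [cite: Bohm1949, Bloch's theorem] -/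
theorem bloch_abs_current_le (hL : 3 ≤ L) (U : ℝ) (N : ℕ) (M : ℝ)
    (φ : Fock (Orb (FermionTorus 2 L))) (hφ : φ ∈ szSector N M) (h1 : star φ ⬝ᵥ φ = 1) :
    |Real.sin (2 * Real.pi / L) *
        (2 * ∑ x : Site 2 L, ∑ σ : Fin 2,
          (star φ ⬝ᵥ ((creation (orb (FermionTorus.ofTorusSite (Site.shift x 0)) σ) *
            annihilation (orb (FermionTorus.ofTorusSite x) σ)) *ᵥ φ)).im)| ≤
      (1 - Real.cos (2 * Real.pi / L)) *
          (2 * ∑ x : Site 2 L, ∑ σ : Fin 2,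
            (star φ ⬝ᵥ ((creation (orb (FermionTorus.ofTorusSite (Site.shift x 0)) σ) *
              annihilation (orb (FermionTorus.ofTorusSite x) σ)) *ᵥ φ)).re) +
        ((star φ ⬝ᵥ (hubbardTorus 2 L 1 U *ᵥ φ)).re -
          (hubbardTorus 2 L 1 U).minEnergyOn (szSector N M)) := by
  have hp := bloch_intTwist_le hL U N M 1 φ hφ h1
  have hm := bloch_intTwist_le hL U N M (-1) φ hφ h1
  simp only [Int.cast_one, one_mul, Int.cast_neg, neg_one_mul, neg_div, Real.cos_neg,
    Real.sin_neg] at hp hm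
  rw [abs_le]
  constructor <;> linarith

/-- **Bloch's theorem for sector ground states**: a unit vector `φ` of the joint sector `(N, M)`
attaining the sector ground energy carries an `e₁`-current of at most
`|sin(2π/L)| · |2J̃(φ)| ≤ (1 − cos(2π/L)) · 2K(φ)`, i.e. `|2J̃| ≤ tan(π/L) · 2K ≈ (2π/L)·K` —
persistent currents of ground states are `O(K/L)`. Bohm, Phys. Rev. 75 (1949) 502; Watanabe (2019)
Theorem in §2.2.1; Tada–Koma (2016) §2. [cite: Bohm1949, Bloch's theorem] -/
theorem bloch_abs_current_le_of_minEnergy (hL : 3 ≤ L) (U : ℝ) (N : ℕ) (M : ℝ)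
    (φ : Fock (Orb (FermionTorus 2 L))) (hφ : φ ∈ szSector N M) (h1 : star φ ⬝ᵥ φ = 1)
    (hgs : (star φ ⬝ᵥ (hubbardTorus 2 L 1 U *ᵥ φ)).re = (hubbardTorus 2 L 1 U).minEnergyOn (szSector N M)) :
    |Real.sin (2 * Real.pi / L) *
        (2 * ∑ x : Site 2 L, ∑ σ : Fin 2,
          (star φ ⬝ᵥ ((creation (orb (FermionTorus.ofTorusSite (Site.shift x 0)) σ) *
            annihilation (orb (FermionTorus.ofTorusSite x) σ)) *ᵥ φ)).im)| ≤
      (1 - Real.cos (2 * Real.pi / L)) *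
          (2 * ∑ x : Site 2 L, ∑ σ : Fin 2,
            (star φ ⬝ᵥ ((creation (orb (FermionTorus.ofTorusSite (Site.shift x 0)) σ) *
              annihilation (orb (FermionTorus.ofTorusSite x) σ)) *ᵥ φ)).re) := by
  have h := bloch_abs_current_le hL U N M φ hφ h1
  rwa [hgs, sub_self, add_zero] at h

/-- The same for a sector ground state in the sense of `IsGroundStateInSector` (a nonzero
eigenvector of `szSector N M` at the sector energy), normalised: its `e₁`-current obeys Bloch's bound.
Bohm (1949); Watanabe (2019) §2.2.1. [cite: Bohm1949, Bloch's theorem] -/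
theorem bloch_abs_current_le_of_isGroundStateInSector (hL : 3 ≤ L) (U : ℝ) (N : ℕ) (M : ℝ)
    (φ : Fock (Orb (FermionTorus 2 L))) (hgs : IsGroundStateInSector (hubbardTorus 2 L 1 U) N M φ)
    (h1 : star φ ⬝ᵥ φ = 1) :
    |Real.sin (2 * Real.pi / L) *
        (2 * ∑ x : Site 2 L, ∑ σ : Fin 2,
          (star φ ⬝ᵥ ((creation (orb (FermionTorus.ofTorusSite (Site.shift x 0)) σ) *
            annihilation (orb (FermionTorus.ofTorusSite x) σ)) *ᵥ φ)).im)| ≤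
      (1 - Real.cos (2 * Real.pi / L)) *
          (2 * ∑ x : Site 2 L, ∑ σ : Fin 2,
            (star φ ⬝ᵥ ((creation (orb (FermionTorus.ofTorusSite (Site.shift x 0)) σ) *
              annihilation (orb (FermionTorus.ofTorusSite x) σ)) *ᵥ φ)).re) := by
  refine bloch_abs_current_le_of_minEnergy hL U N M φ hgs.1 h1 ?_
  rw [hgs.2.2, dotProduct_smul, h1, smul_eq_mul, mul_one, Complex.ofReal_re]

end Literature.MathematicalPhysics.QuantumLattice
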